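import Mathlib
import Summits.ValiantsHypothesis.ValiantsHypothesis.Theorems.LacunarySymmetroidMatrixDescartesTieLawAlgebra
import Summits.ValiantsHypothesis.ValiantsHypothesis.Theorems.LacunarySymmetroidMatrixDescartesTieLawRotation
import HarnessLib

/-!
# ValiantsHypothesis / LacunarySymmetroid — crux `MatrixDescartes` (stmt-ValiantsHypothesis-18050, V1), LINE (A) «product_plus_one»:
# the TIE LAW, kernel path Stage 2, part 4a — (I1) over `ℂ[X]`, the pointwise ray package for the boundary lemma

With `ω = e^{iπ/c}`, `ε = ω² = e^{2πi/c}`, `c = a + b`, a well `(β, γ)` and its real trinomial `g = γX^c + X^a − β`: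
* `map_qPoly_eq` — (I1) as a polynomial identity over `ℂ`: `q = g(ω·)·g(ω̄·)`, hence `roots_map_qPoly`;
* the pointwise package on the upper tie ray `x₀ = t ω` (`t > 0`): `q(x₀) = g(tε)·g(t)`, (I2)
  `K x₀^a n(x₀) = U·g(t) − V·g(tε)` with `K = ω^a − ω̄^a ≠ 0`, `U = (εt) g′(εt)`, `V = t g′(t)`, and (I3) `Im(U·conj g(tε)) < 0`;
* `ray_im_div_neg` — `Im(U / g(tε)) < 0` (the «no node on the partner ray» half of (I3)).
The sums over wells and the boundary lemma itself (pen val-idea-25 g8, HOME NOTE §45.2) are in `…TieLawBoundarySum`.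
HONEST FRAMING: helper lemmas; no stub of LINE (A) is touched; `MatrixDescartes` OPEN; `VP ≠ VNP` is NOT proved.  No definitions,
no named facts.
-/

set_option linter.dupNamespace false

namespace Summit.ValiantsHypothesis.ValiantsHypothesis.Theorems.LacunarySymmetroidMatrixDescartes

namespace TieLaw

open Polynomial Filter Topology

section Boundary

variable {a b c : ℕ} {β γ : ℝ}

/-! ### `ω = e^{iπ/c}` -/

/-- `ω^c = −1`. -/
theorem rot_pi_div_pow (hc : c ≠ 0) : rot (Real.pi / c) ^ c = -1 := by
  rw [← rot_nat_mul, show (c : ℝ) * (Real.pi / c) = Real.pi by field_simp, rot]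
  exact Complex.exp_pi_mul_I

/-- `ω · ω = ε`. -/
theorem rot_pi_div_mul_self (c : ℕ) : rot (Real.pi / c) * rot (Real.pi / c) = rot (2 * Real.pi / c) := by
  rw [← rot_add]
  congr 1
  ring

/-- `conj ε = ε̄`, stated for `2π/c`. -/
theorem rot_two_pi_neg_mul (c : ℕ) : rot (-(2 * Real.pi / c)) * rot (2 * Real.pi / c) = 1 := rot_neg_mul_rot _

/-- `ω^a + ω̄^a = 2 cos(πa/c)` (as complex numbers). -/
theorem rot_pow_add_rot_neg_pow (a c : ℕ) :
    rot (Real.pi / c) ^ a + rot (-(Real.pi / c)) ^ a = ((2 * Real.cos (Real.pi * a / c) : ℝ) : ℂ) := by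
  rw [← rot_nat_mul, ← rot_nat_mul, show (a : ℝ) * -(Real.pi / c) = -(a * (Real.pi / c)) by ring,
    show Real.pi * a / c = a * (Real.pi / c) by ring]
  apply Complex.ext
  · rw [Complex.add_re, rot_re, rot_re, Real.cos_neg, Complex.ofReal_re, two_mul]
  · rw [Complex.add_im, rot_im, rot_im, Real.sin_neg, Complex.ofReal_im, add_neg_cancel]

/-- `e^{iaθ} − e^{−iaθ} = 2 sin(aθ)·i`. -/
theorem rot_pow_sub_rot_neg_pow_eq (a : ℕ) (θ : ℝ) :
    rot θ ^ a - rot (-θ) ^ a = ((2 * Real.sin (a * θ) : ℝ) : ℂ) * Complex.I := by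
  rw [← rot_nat_mul, ← rot_nat_mul, show (a : ℝ) * -θ = -(a * θ) by ring]
  apply Complex.ext
  · rw [Complex.sub_re, rot_re, rot_re, Real.cos_neg, sub_self, Complex.mul_re, Complex.ofReal_re,
      Complex.ofReal_im, Complex.I_re, Complex.I_im]
    ring
  · rw [Complex.sub_im, rot_im, rot_im, Real.sin_neg, sub_neg_eq_add, Complex.mul_im, Complex.ofReal_re,
      Complex.ofReal_im, Complex.I_re, Complex.I_im]
    ring

/-- `K = ω^a − ω̄^a ≠ 0` for `0 < a < c`. -/
theorem rot_pow_sub_rot_neg_pow_ne_zero (ha : 0 < a) (hac : a < c) :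
    rot (Real.pi / c) ^ a - rot (-(Real.pi / c)) ^ a ≠ 0 := by
  rw [rot_pow_sub_rot_neg_pow_eq]
  have hc : (0 : ℝ) < c := by exact_mod_cast (lt_trans ha hac)
  have hsin : 0 < Real.sin (a * (Real.pi / c)) := by
    apply Real.sin_pos_of_pos_of_lt_pi
    · have : (0 : ℝ) < a := by exact_mod_cast ha
      positivity
    · rw [show (a : ℝ) * (Real.pi / c) = Real.pi * (a / c) by ring]
      have : (a : ℝ) / c < 1 := (div_lt_one hc).2 (by exact_mod_cast hac)
      nlinarith [Real.pi_pos]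
  intro h
  have h1 := (mul_eq_zero.1 h).resolve_right Complex.I_ne_zero
  have h2 := Complex.ofReal_eq_zero.1 h1
  linarith

/-! ### The complexified well polynomials, pointwise -/

/-- `g(z) = γ z^c + z^a − β` over `ℂ`. -/
theorem map_gPoly_eval (a c : ℕ) (β γ : ℝ) (z : ℂ) :
    ((gPoly a c β γ).map (algebraMap ℝ ℂ)).eval z = γ * z ^ c + z ^ a - β := by
  simp [gPoly, eval_add, eval_sub, eval_mul, eval_pow, eval_C, eval_X]

/-- `g` over `ℂ` is the `s = 1` member of the deformation family of `…TieLawRotation`. -/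
theorem map_gPoly_eq (a c : ℕ) (β γ : ℝ) :
    (gPoly a c β γ).map (algebraMap ℝ ℂ) = (C (γ : ℂ) * X ^ c - C (β : ℂ)) + C ((1 : ℝ) : ℂ) * X ^ a := by
  rw [← gFam_map, gPoly, C_1, one_mul]

/-- `n(z) = bγ z^c − aβ` over `ℂ`. -/
theorem map_nPoly_eval (a b c : ℕ) (β γ : ℝ) (z : ℂ) :
    ((nPoly a b c β γ).map (algebraMap ℝ ℂ)).eval z = b * γ * z ^ c - a * β := by
  simp [nPoly, eval_sub, eval_mul, eval_pow, eval_C, eval_X]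

/-- Conjugation commutes with evaluating the real polynomial `g`. -/
theorem conj_map_gPoly_eval (a c : ℕ) (β γ : ℝ) (z : ℂ) :
    (starRingEnd ℂ) (((gPoly a c β γ).map (algebraMap ℝ ℂ)).eval z) =
      ((gPoly a c β γ).map (algebraMap ℝ ℂ)).eval ((starRingEnd ℂ) z) := by
  rw [map_gPoly_eval, map_gPoly_eval]
  simp

/-- `g(tε) ≠ 0` for `t > 0` (`0 < a`, `2a < c`): the ray `arg = 2π/c` carries no root of `g`. -/
theorem map_gPoly_eval_ray_ne_zero (ha : 0 < a) (h2a : 2 * a < c) (β γ : ℝ) {t : ℝ} (ht : 0 < t) :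
    ((gPoly a c β γ).map (algebraMap ℝ ℂ)).eval ((t : ℂ) * rot (2 * Real.pi / c)) ≠ 0 := by
  rw [map_gPoly_eq]
  exact gFamC_eval_ray_ne_zero ha h2a one_pos β γ ht

/-- A positive real `t` with `g(t) ≠ 0` over `ℝ` gives `g(t) ≠ 0` over `ℂ`, and conversely; we record the cast formula. -/
theorem map_gPoly_eval_ofReal (a c : ℕ) (β γ t : ℝ) :
    ((gPoly a c β γ).map (algebraMap ℝ ℂ)).eval (t : ℂ) = (((gPoly a c β γ).eval t : ℝ) : ℂ) := by
  rw [map_gPoly_eval]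
  simp [gPoly, eval_add, eval_sub, eval_mul, eval_pow, eval_C, eval_X]

/-! ### (I1) over `ℂ[X]` and the roots of `q` -/

/-- **(I1) as a polynomial identity**: `q = g(ω X) · g(ω̄ X)` over `ℂ`. -/
theorem map_qPoly_eq (hc : c ≠ 0) (a : ℕ) (β γ : ℝ) :
    (qPoly a c β γ).map (algebraMap ℝ ℂ) =
      ((gPoly a c β γ).map (algebraMap ℝ ℂ)).comp (C (rot (Real.pi / c)) * X) *
        ((gPoly a c β γ).map (algebraMap ℝ ℂ)).comp (C (rot (-(Real.pi / c))) * X) := by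
  have hω : (C (rot (Real.pi / c)) : ℂ[X]) ^ c = -1 := by
    rw [← C_pow, rot_pi_div_pow hc, C_neg, C_1]
  have hinv : (C (rot (Real.pi / c)) : ℂ[X]) * C (rot (-(Real.pi / c))) = 1 := by
    rw [← C_mul, rot_mul_rot_neg, C_1]
  have h := I1 (R := ℂ[X]) (C (rot (Real.pi / c))) (C (rot (-(Real.pi / c)))) (C (β : ℂ)) (C (γ : ℂ)) X a c
    hω hinv
  have hcos : (C (rot (Real.pi / c)) : ℂ[X]) ^ a + C (rot (-(Real.pi / c))) ^ a =
      C (((2 * Real.cos (Real.pi * a / c) : ℝ) : ℂ)) := by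
    rw [← C_pow, ← C_pow, ← C_add, rot_pow_add_rot_neg_pow]
  have hg : ∀ u : ℂ, ((gPoly a c β γ).map (algebraMap ℝ ℂ)).comp (C u * X) =
      C (γ : ℂ) * (C u * X) ^ c + (C u * X) ^ a - C (β : ℂ) := by
    intro u
    simp only [gPoly, Polynomial.map_add, Polynomial.map_sub, Polynomial.map_mul, Polynomial.map_pow, map_C,
      map_X, add_comp, sub_comp, mul_comp, pow_comp, C_comp, X_comp, Complex.coe_algebraMap]
  rw [hg, hg, h, hcos]
  simp only [qPoly, mPoly, Polynomial.map_add, Polynomial.map_sub, Polynomial.map_mul, Polynomial.map_pow, map_C,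
    map_X, Complex.coe_algebraMap]

/-- `q(x) = g(ω x) · g(ω̄ x)` pointwise over `ℂ`. -/
theorem map_qPoly_eval (hc : c ≠ 0) (a : ℕ) (β γ : ℝ) (x : ℂ) :
    ((qPoly a c β γ).map (algebraMap ℝ ℂ)).eval x =
      ((gPoly a c β γ).map (algebraMap ℝ ℂ)).eval (rot (Real.pi / c) * x) *
        ((gPoly a c β γ).map (algebraMap ℝ ℂ)).eval (rot (-(Real.pi / c)) * x) := by
  rw [map_qPoly_eq hc, eval_mul, eval_comp, eval_comp]
  simp only [eval_mul, eval_C, eval_X]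

/-- `g ≠ 0` over `ℂ` (its `c`-th coefficient is `γ ≠ 0`, `a < c`). -/
theorem map_gPoly_ne_zero (hac : a < c) (β : ℝ) (hγ : γ ≠ 0) : (gPoly a c β γ).map (algebraMap ℝ ℂ) ≠ 0 := by
  intro h
  have := congrArg (fun p => p.coeff c) h
  simp only [map_gPoly_eq, gFamC_coeff_top hac, coeff_zero] at this
  exact hγ (by exact_mod_cast this)

/-- The complex roots of `q`: the roots of `g` rotated by `ω̄` together with the roots of `g` rotated by `ω`. -/
theorem roots_map_qPoly (ha : 0 < a) (hac : a < c) (β : ℝ) (hγ : γ ≠ 0) :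
    ((qPoly a c β γ).map (algebraMap ℝ ℂ)).roots =
      ((gPoly a c β γ).map (algebraMap ℝ ℂ)).roots.map (fun ρ => rot (-(Real.pi / c)) * ρ) +
        ((gPoly a c β γ).map (algebraMap ℝ ℂ)).roots.map (fun ρ => rot (Real.pi / c) * ρ) := by
  have hc : c ≠ 0 := by omega
  have hg0 := map_gPoly_ne_zero hac β hγ
  have hu1 : IsUnit (rot (Real.pi / c)) := (rot_ne_zero _).isUnit
  have hu2 : IsUnit (rot (-(Real.pi / c))) := (rot_ne_zero _).isUnit
  have hc1 : ((gPoly a c β γ).map (algebraMap ℝ ℂ)).comp (C (rot (Real.pi / c)) * X) ≠ 0 := fun h =>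
    hg0 (comp_eq_zero_iff.1 h |>.resolve_right (by simp [hu1.ne_zero]) )
  have hc2 : ((gPoly a c β γ).map (algebraMap ℝ ℂ)).comp (C (rot (-(Real.pi / c))) * X) ≠ 0 := fun h =>
    hg0 (comp_eq_zero_iff.1 h |>.resolve_right (by simp [hu2.ne_zero]))
  rw [map_qPoly_eq hc, roots_mul (mul_ne_zero hc1 hc2)]
  have e1 : ((gPoly a c β γ).map (algebraMap ℝ ℂ)).comp (C (rot (Real.pi / c)) * X) =
      ((gPoly a c β γ).map (algebraMap ℝ ℂ)).comp (C (rot (Real.pi / c)) * X + C 0) := by rw [C_0, add_zero]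
  have e2 : ((gPoly a c β γ).map (algebraMap ℝ ℂ)).comp (C (rot (-(Real.pi / c))) * X) =
      ((gPoly a c β γ).map (algebraMap ℝ ℂ)).comp (C (rot (-(Real.pi / c))) * X + C 0) := by rw [C_0, add_zero]
  rw [e1, e2, roots_comp_C_mul_X_add_C _ _ _ hu1, roots_comp_C_mul_X_add_C _ _ _ hu2]
  have i1 : Ring.inverse (rot (Real.pi / c)) = rot (-(Real.pi / c)) := by
    rw [Ring.inverse_eq_inv']
    exact (eq_inv_of_mul_eq_one_left (rot_neg_mul_rot _)).symm
  have i2 : Ring.inverse (rot (-(Real.pi / c))) = rot (Real.pi / c) := by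
    rw [Ring.inverse_eq_inv']
    exact (eq_inv_of_mul_eq_one_left (rot_mul_rot_neg _)).symm
  simp only [i1, i2, sub_zero]

/-! ### The pointwise package on the upper tie ray `x₀ = t ω` -/

/-- `ω · (t ω) = t ε`. -/
theorem omega_mul_ray (c : ℕ) (t : ℝ) :
    rot (Real.pi / c) * ((t : ℂ) * rot (Real.pi / c)) = (t : ℂ) * rot (2 * Real.pi / c) := by
  rw [mul_left_comm, rot_pi_div_mul_self]

/-- `ω̄ · (t ω) = t`. -/
theorem omegaBar_mul_ray (c : ℕ) (t : ℝ) :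
    rot (-(Real.pi / c)) * ((t : ℂ) * rot (Real.pi / c)) = (t : ℂ) := by
  rw [mul_left_comm, rot_neg_mul_rot, mul_one]

/-- `q(t ω) = g(t ε) · g(t)` (as a complex number; `g(t)` is the real value cast). -/
theorem map_qPoly_eval_ray (hc : c ≠ 0) (a : ℕ) (β γ t : ℝ) :
    ((qPoly a c β γ).map (algebraMap ℝ ℂ)).eval ((t : ℂ) * rot (Real.pi / c)) =
      ((gPoly a c β γ).map (algebraMap ℝ ℂ)).eval ((t : ℂ) * rot (2 * Real.pi / c)) *
        (((gPoly a c β γ).eval t : ℝ) : ℂ) := by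
  rw [map_qPoly_eval hc, omega_mul_ray, omegaBar_mul_ray, map_gPoly_eval_ofReal]

/-- **(I2) on the ray**: `K (tω)^a n(tω) = U·g(t) − V·g(tε)` with `K = ω^a − ω̄^a`, `U = (εt)g′(εt) = cγ(tε)^c + a(tε)^a`,
`V = t g′(t) = cγt^c + a t^a`. -/
theorem ray_I2 (hc : c = a + b) (ha : 0 < a) (β γ t : ℝ) :
    (rot (Real.pi / c) ^ a - rot (-(Real.pi / c)) ^ a) * ((t : ℂ) * rot (Real.pi / c)) ^ a *
        ((nPoly a b c β γ).map (algebraMap ℝ ℂ)).eval ((t : ℂ) * rot (Real.pi / c)) =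
      ((c : ℂ) * γ * ((t : ℂ) * rot (2 * Real.pi / c)) ^ c + a * ((t : ℂ) * rot (2 * Real.pi / c)) ^ a) *
          (((gPoly a c β γ).eval t : ℝ) : ℂ) -
        (((c * γ * t ^ c + a * t ^ a : ℝ)) : ℂ) *
          ((gPoly a c β γ).map (algebraMap ℝ ℂ)).eval ((t : ℂ) * rot (2 * Real.pi / c)) := by
  have hc0 : c ≠ 0 := by omega
  have hω : rot (Real.pi / c) ^ c = -1 := rot_pi_div_pow hc0
  have hinv : rot (Real.pi / c) * rot (-(Real.pi / c)) = 1 := rot_mul_rot_neg _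
  have h := I2 (R := ℂ) (rot (Real.pi / c)) (rot (-(Real.pi / c))) (β : ℂ) (γ : ℂ) ((t : ℂ) * rot (Real.pi / c))
    a b c hc hω hinv
  rw [omega_mul_ray, omegaBar_mul_ray] at h
  rw [map_nPoly_eval, map_gPoly_eval, ← map_gPoly_eval_ofReal, map_gPoly_eval, h]
  push_cast
  ring

/-- **(I3) on the ray**: `Im(U · conj g(tε)) = −sin(2πa/c)·t^a·(bγt^c + aβ)`. -/
theorem ray_I3_im (hc : c = a + b) (ha : 0 < a) (β γ t : ℝ) :
    (((c : ℂ) * γ * ((t : ℂ) * rot (2 * Real.pi / c)) ^ c + a * ((t : ℂ) * rot (2 * Real.pi / c)) ^ a) *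
        (starRingEnd ℂ) (((gPoly a c β γ).map (algebraMap ℝ ℂ)).eval ((t : ℂ) * rot (2 * Real.pi / c)))).im =
      -(Real.sin (a * (2 * Real.pi / c)) * (t ^ a * (b * γ * t ^ c + a * β))) := by
  have hc0 : c ≠ 0 := by omega
  set ε := rot (2 * Real.pi / c) with hε
  have hεc : ε ^ c = 1 := rot_two_pi_div_pow c hc0
  have hinv : ε * rot (-(2 * Real.pi / c)) = 1 := rot_mul_rot_neg _
  have h := I3 (R := ℂ) ε (rot (-(2 * Real.pi / c))) (β : ℂ) (γ : ℂ) (t : ℂ) a b c hc hεc hinv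
  -- identify the conjugates
  have hconjε : (starRingEnd ℂ) ε = rot (-(2 * Real.pi / c)) := conj_rot _
  set G := ((gPoly a c β γ).map (algebraMap ℝ ℂ)).eval ((t : ℂ) * ε) with hG
  set U := (c : ℂ) * γ * ((t : ℂ) * ε) ^ c + a * ((t : ℂ) * ε) ^ a with hU
  have hGc : (starRingEnd ℂ) G = γ * (rot (-(2 * Real.pi / c)) * t) ^ c + (rot (-(2 * Real.pi / c)) * t) ^ a - β := by
    rw [hG, map_gPoly_eval]
    simp only [map_add, map_sub, map_mul, map_pow, Complex.conj_ofReal, hconjε]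
    ring
  have hUc : (starRingEnd ℂ) U = (c : ℂ) * γ * (rot (-(2 * Real.pi / c)) * t) ^ c + a * (rot (-(2 * Real.pi / c)) * t) ^ a := by
    rw [hU]
    simp only [map_add, map_mul, map_pow, Complex.conj_ofReal, hconjε, map_natCast]
    ring
  have hGe : G = γ * (ε * t) ^ c + (ε * t) ^ a - β := by rw [hG, map_gPoly_eval]; ring
  have hUe : U = (c : ℂ) * γ * (ε * t) ^ c + a * (ε * t) ^ a := by rw [hU]; ring
  -- (I3) reads `U * conj G - conj U * G = -((ε^a - ε̄^a) t^a (bγ t^c + aβ))`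
  have key : U * (starRingEnd ℂ) G - (starRingEnd ℂ) U * G =
      -((ε ^ a - rot (-(2 * Real.pi / c)) ^ a) * (t : ℂ) ^ a * ((b : ℂ) * γ * (t : ℂ) ^ c + (a : ℂ) * β)) := by
    rw [hGc, hUc, hUe, hGe]
    exact h
  have him := congrArg Complex.im key
  have h2 : (U * (starRingEnd ℂ) G - (starRingEnd ℂ) U * G).im = 2 * (U * (starRingEnd ℂ) G).im := by
    have : (starRingEnd ℂ) U * G = (starRingEnd ℂ) (U * (starRingEnd ℂ) G) := by
      rw [map_mul, Complex.conj_conj]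
    rw [Complex.sub_im, this, Complex.conj_im]
    ring
  rw [h2, hε, rot_pow_sub_rot_neg_pow_eq] at him
  have h3 : (-(((2 * Real.sin (a * (2 * Real.pi / c)) : ℝ) : ℂ) * Complex.I * (t : ℂ) ^ a *
      ((b : ℂ) * γ * (t : ℂ) ^ c + (a : ℂ) * β))).im =
      -(2 * Real.sin (a * (2 * Real.pi / c)) * (t ^ a * (b * γ * t ^ c + a * β))) := by
    have : (((2 * Real.sin (a * (2 * Real.pi / c)) : ℝ) : ℂ) * Complex.I * (t : ℂ) ^ a *
        ((b : ℂ) * γ * (t : ℂ) ^ c + (a : ℂ) * β)) =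
        ((2 * Real.sin (a * (2 * Real.pi / c)) * (t ^ a * (b * γ * t ^ c + a * β)) : ℝ) : ℂ) * Complex.I := by
      push_cast
      ring
    rw [this, Complex.neg_im, Complex.mul_im, Complex.ofReal_re, Complex.ofReal_im, Complex.I_re, Complex.I_im]
    ring
  rw [h3] at him
  linarith

/-- `Im(U / g(tε)) < 0` for `t > 0` (the well's logarithmic derivative along the partner ray has negative imaginary
part: the «no node» half of (I3)). -/
theorem ray_im_div_neg (hc : c = a + b) (ha : 0 < a) (hab : a < b) (hβ : 0 < β) (hγ : 0 < γ) {t : ℝ}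
    (ht : 0 < t) :
    (((c : ℂ) * γ * ((t : ℂ) * rot (2 * Real.pi / c)) ^ c + a * ((t : ℂ) * rot (2 * Real.pi / c)) ^ a) /
        ((gPoly a c β γ).map (algebraMap ℝ ℂ)).eval ((t : ℂ) * rot (2 * Real.pi / c))).im < 0 := by
  have h2a : 2 * a < c := by omega
  set G := ((gPoly a c β γ).map (algebraMap ℝ ℂ)).eval ((t : ℂ) * rot (2 * Real.pi / c)) with hG
  set U := (c : ℂ) * γ * ((t : ℂ) * rot (2 * Real.pi / c)) ^ c + a * ((t : ℂ) * rot (2 * Real.pi / c)) ^ a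
    with hU
  have hG0 : G ≠ 0 := map_gPoly_eval_ray_ne_zero ha h2a β γ ht
  have hns : 0 < Complex.normSq G := Complex.normSq_pos.2 hG0
  have hdiv : U / G = U * (starRingEnd ℂ) G * ((Complex.normSq G)⁻¹ : ℝ) := by
    rw [div_eq_mul_inv, Complex.inv_def, mul_assoc]
  rw [hdiv, Complex.im_mul_ofReal, hG, hU, ray_I3_im hc ha]
  have hsin : 0 < Real.sin (a * (2 * Real.pi / c)) := by
    rw [show (a : ℝ) * (2 * Real.pi / c) = 2 * Real.pi * a / c by ring]
    exact sin_two_pi_mul_div_pos ha h2a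
  have hpos : 0 < Real.sin (a * (2 * Real.pi / c)) * (t ^ a * (b * γ * t ^ c + a * β)) := by
    have hb : (0 : ℝ) < b := by exact_mod_cast (lt_trans ha hab)
    have ha' : (0 : ℝ) < a := by exact_mod_cast ha
    positivity
  have : 0 < (Complex.normSq G)⁻¹ := inv_pos.2 hns
  nlinarith

end Boundary

end TieLaw

end Summit.ValiantsHypothesis.ValiantsHypothesis.Theorems.LacunarySymmetroidMatrixDescartes
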